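import Summits.HodgeConjecture.HodgeConjecture.Theses.LinearSystemTorelli
import Summits.HodgeConjecture.HodgeConjecture.Theorems.CurveNetMordellWeilVerticalSupportMiddleHardness
import Literature.AlgebraicGeometry.HodgeTheory.PencilStepBelowMiddleHolds
import Literature.AlgebraicGeometry.HodgeTheory.HardLefschetzNFoldHolds
import Literature.AlgebraicGeometry.HodgeTheory.LefschetzOneOneHolds
import Literature.AlgebraicGeometry.HodgeTheory.SaitoGrFDeRhamCurveNetHolds
import Literature.AlgebraicGeometry.HodgeTheory.HodgeRiemannPolarizabilityProofs
import Literature.AlgebraicGeometry.HodgeTheory.ClassesSupportedOn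
import Literature.Barriers.HodgeConjecture.DecompositionOfTheDiagonal

/-!
# Sketch — crux stmt-HodgeConjecture-1081 `LinearSystemTorelli.MiddleDivisorSupport`
(crux-ideate round 1, ideator 1, 2026-08-17; planner scratch, NOT a skeleton)

Typed first lemmas for the two idea cards of this seat.

* CARD B `middle-step-heartland-transfer`: the crux BY NAME follows from the level-wise middle
  step of the Hodge conjecture with the dimension-induction hypothesis INTERNAL
  (`middleDivisorSupport_of_middleStep`), hence from the two regimes of the Bloch–Srinivas
  dichotomy (`middleDivisorSupport_of_regimes`) — PROVED. The statements `HodgeBelowDim`,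
  `MiddleStepFor`, `ChowZeroDegenerate`, `MiddleStepChowDegenerate`, `MiddleStepHeartland` and the
  reduction `hodgeConjecture_of_middleStep` are VERBATIM COPIES (same bodies ⇒ `Iff.rfl`) of the
  sibling crux stmt-2782's registered line `Cruxes/VerticalSupportMiddle/Lines/regime_split_middle_step.lean`
  (strategist p1, 2026-08-17), copied only because that Lines module is not built on the farm for
  import; ONE heart serves 1081 / 2782 / 2409 (dedup).
* CARD A `ah-thomas-node-restoration`: the typed LANDING PAD of a codimension-one production
  engine on the heart — `CarryingUpToAlgebraic` — implies the heart (`heartland_of_carrying`,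
  PROVED: support calculus + Deligne descent under the hypothesis); the a.h. node-restoration scheme
  of the card delivers it with D = a holomorphic nodal hypersurface section, b = −(multiple of h^q).
-/

noncomputable section

set_option linter.dupNamespace false

open CategoryTheory AlgebraicGeometry
open Literature.AlgebraicGeometry Literature.AlgebraicGeometry.Motives
  Literature.AlgebraicGeometry.HodgeTheory Literature.AlgebraicTopology.SingularHomology
open Summit.HodgeConjecture.HodgeConjecture.Theses.LinearSystemTorelli (MiddleDivisorSupport)
open Summit.HodgeConjecture.HodgeConjecture.Theorems
  (supportedHodgeClass_mem_algebraicClasses_of_codim_lt)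

namespace Summit.HodgeConjecture.HodgeConjecture.Cruxes.MiddleDivisorSupport.IdeatorOneSketch

/-! ### Statements (verbatim copies of `RegimeSplitMiddleStep`'s, stmt-2782) -/

/-- HC for all smooth projective complex varieties of dimension `< N` (the induction hypothesis). -/
def HodgeBelowDim (N : ℕ) : Prop :=
  ∀ ⦃n : ℕ⦄ ⦃Y : SchemeOver ℂ⦄, n < N → IsSmoothProjective n Y →
    ∀ (p : ℕ) (c : complexBetti Y (2 * p)), IsRationalClass c → IsOfHodgeType n Y (2 * p) p p c →
      c ∈ algebraicClasses Y p

/-- `CH₀(X)` supported on a proper Zariski-closed subset (Bloch–Srinivas hypothesis). -/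
def ChowZeroDegenerate (X : SchemeOver ℂ) : Prop :=
  ∃ W : Set X.left, IsClosed W ∧ W ≠ Set.univ ∧ ∀ z ∈ cyclesOfDim X.left 0,
    ∃ z' ∈ cyclesOfDim X.left 0, (∀ x, z' x ≠ 0 → x ∈ W) ∧ IsRationallyEquivalent z z' 0

/-- The middle-dimensional step of HC at level `q ≥ 2` on the `2q`-folds singled out by `P`. -/
def MiddleStepFor (P : ∀ X : SchemeOver ℂ, Prop) : Prop :=
  ∀ ⦃q : ℕ⦄ ⦃X : SchemeOver ℂ⦄, 2 ≤ q → IsSmoothProjective (2 * q) X → HodgeBelowDim (2 * q) → P X →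
    ∀ c : complexBetti X (2 * q), IsRationalClass c → IsOfHodgeType (2 * q) X (2 * q) q q c →
      c ∈ algebraicClasses X q

/-- Regime 1 (CH₀-degenerate 2q-folds). -/
def MiddleStepChowDegenerate : Prop := MiddleStepFor ChowZeroDegenerate

/-- Regime 2 — THE HEART (CH₀-non-degenerate 2q-folds, ⊇ `h^{2q,0} ≠ 0`). -/
def MiddleStepHeartland : Prop := MiddleStepFor fun X ↦ ¬ ChowZeroDegenerate X

/-! ### Proved (copies): supported Hodge classes algebraic under the hypothesis; level-wise reduction -/

theorem supportedHodgeClasses_algebraic_of_hodgeBelowDim {n : ℕ} (ih : HodgeBelowDim n)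
    {X : SchemeOver ℂ} (hX : IsSmoothProjective n X) {p : ℕ} (c : complexBetti X (2 * p))
    (hc : IsRationalClass c) (hpp : IsOfHodgeType n X (2 * p) p p c)
    (hsupp : c ∈ supportedClasses X (2 * p) 1) : c ∈ algebraicClasses X p :=
  supportedHodgeClass_mem_algebraicClasses_of_codim_lt
    Deligne1974_ker_restrictCompl_eq_iSup_range_complexGysin_holds
    Voisin2025_hodgeClass_lift_complexGysin_holds hX
    (fun _ d _ hm _ hY β hβ hβ' ↦ ih hm hY d β hβ hβ') c hc hpp hsupp

theorem middleStep_of_regimes (hD : MiddleStepChowDegenerate) (hH : MiddleStepHeartland) :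
    MiddleStepFor fun _ ↦ True := by
  intro q X hq hX ih _ c hc hh
  by_cases hW : ChowZeroDegenerate X
  · exact hD hq hX ih hW c hc hh
  · exact hH hq hX ih hW c hc hh

theorem hodge_below_middle_of_hodgeBelowDim {n : ℕ} (ih : HodgeBelowDim n) {X : SchemeOver ℂ}
    (hX : IsSmoothProjective n X) (p : ℕ) (hp : 2 * p < n) (c : complexBetti X (2 * p))
    (hc : IsRationalClass c) (hh : IsOfHodgeType n X (2 * p) p p c) : c ∈ algebraicClasses X p := by
  obtain ⟨m, rfl⟩ : ∃ m, n = m + 1 := ⟨n - 1, by omega⟩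
  exact mem_algebraicClasses_of_two_mul_le hX (fun Y hY q c hc hh ↦ ih (lt_add_one m) hY q c hc hh)
    p c (by omega) hc hh

theorem hodge_of_hodgeBelowDim_of_middleStep {n : ℕ} (ih : HodgeBelowDim n)
    (mid : MiddleStepFor fun _ ↦ True) {X : SchemeOver ℂ}
    (hX : IsSmoothProjective n X) (p : ℕ) (c : complexBetti X (2 * p)) (hc : IsRationalClass c)
    (hh : IsOfHodgeType n X (2 * p) p p c) : c ∈ algebraicClasses X p := by
  rcases lt_trichotomy (2 * p) n with hlt | heq | hgt
  · exact hodge_below_middle_of_hodgeBelowDim ih hX p hlt c hc hh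
  · rcases Nat.lt_or_ge p 2 with hp2 | hp2
    · interval_cases p
      · rw [algebraicClasses_zero]
        exact Submodule.mem_top
      · exact lefschetzOneOne_rational_holds hX c hc hh
    · subst heq
      exact mid hp2 hX ih trivial c hc hh
  · refine HardLefschetzNFold.mem_algebraicClasses_of_lt_holds hX hgt (fun c' hc' hh' ↦ ?_) c hc hh
    rcases Nat.lt_or_ge (2 * (n - p)) n with hlow | hzero
    · exact hodge_below_middle_of_hodgeBelowDim ih hX (n - p) hlow c' hc' hh'
    · have h0 : n - p = 0 := by omega
      generalize n - p = k at c' hh' h0 ⊢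
      subst h0
      rw [algebraicClasses_zero]
      exact Submodule.mem_top

/-- Level-wise reduction of HC to its middle step (strong induction on the dimension). -/
theorem hodgeConjecture_of_middleStep (mid : MiddleStepFor fun _ ↦ True) : _root_.HodgeConjecture := by
  have main : ∀ n : ℕ, HodgeBelowDim (n + 1) := by
    intro n
    induction n using Nat.strong_induction_on with
    | _ n ihn =>
      intro n' X hn' hX p c hc hh
      have ih : HodgeBelowDim n' := by
        intro k Y hk hY p' c' hc' hh'
        rcases Nat.eq_zero_or_pos n with h0 | hpos
        · omega
        · exact ihn (n - 1) (by omega) (by omega) hY p' c' hc' hh'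
      exact hodge_of_hodgeBelowDim_of_middleStep ih mid hX p c hc hh
  intro n X hX
  exact ⟨(nonempty_hodgeModel_holds (n := n) (X := X)).nonempty hX,
    fun p c hc hh ↦ main n (lt_add_one n) hX p c hc hh⟩

/-! ### CARD B — the crux from the induction-internal middle step -/

/-- `S → crux` (3 lines): `algebraicClasses X p = Nᵖ ≤ N¹` for `p ≥ 1`. [folklore] -/
theorem middleDivisorSupport_of_hodgeConjecture (hHC : _root_.HodgeConjecture) :
    MiddleDivisorSupport := by
  intro p X hp hX c hc hh
  exact supportedClasses_mono X (2 * p) hp ((hHC hX).2 p c hc hh)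

/-- **The crux from the level-wise middle step**: the induction hypothesis becomes AVAILABLE to every
line on stmt-1081. [folklore] -/
theorem middleDivisorSupport_of_middleStep (mid : MiddleStepFor fun _ ↦ True) :
    MiddleDivisorSupport :=
  middleDivisorSupport_of_hodgeConjecture (hodgeConjecture_of_middleStep mid)

/-- **The crux from the two Bloch–Srinivas regimes** (same three statements as stmt-2782's line).
[cite: VoisinHodgeII2003, Cor. 10.21, Prop. 10.26, Thm. 10.17] -/
theorem middleDivisorSupport_of_regimes
    (h₁ : Literature.Barriers.HodgeConjecture.BlochSrinivas1983_decompositionOfTheDiagonal)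
    (h₂ : Literature.Barriers.HodgeConjecture.BlochSrinivas1983_decompositionOfTheDiagonal →
      MiddleStepChowDegenerate)
    (h₃ : MiddleStepHeartland) : MiddleDivisorSupport :=
  middleDivisorSupport_of_middleStep (middleStep_of_regimes (h₂ h₁) h₃)

/-! ### CARD A — landing pad of a codimension-one production engine on the heart -/

/-- **Carrying up to an algebraic summand**: under HC in dimensions `< 2q`, on a CH₀-non-degenerate
smooth projective `2q`-fold, for every rational `(q,q)`-class `c` there are a Zariski-closed `D` of
codimension `≥ 1`, `m ≠ 0` and an algebraic `b` with `m • c + b` supported on `D`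
(a.h. scheme: `D` = holomorphic NODAL hypersurface section, `b` = −(multiple of `h^q`), `m ∈ ℕ`). -/
def CarryingUpToAlgebraic : Prop :=
  ∀ ⦃q : ℕ⦄ ⦃X : SchemeOver ℂ⦄, 2 ≤ q → IsSmoothProjective (2 * q) X → HodgeBelowDim (2 * q) →
    ¬ ChowZeroDegenerate X →
    ∀ c : complexBetti X (2 * q), IsRationalClass c → IsOfHodgeType (2 * q) X (2 * q) q q c →
      ∃ D : Set X.left, IsClosed D ∧ (∀ z ∈ D, (1 : ℕ∞) ≤ Order.coheight z) ∧
        ∃ m : ℂ, m ≠ 0 ∧ ∃ b ∈ algebraicClasses X q, m • c + b ∈ classesSupportedOn X D (2 * q)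

/-- **Landing pad ⟹ heart** (PROVED). [cite: DeligneHodgeIII1974, Cor. 8.2.8] [cite: Voisin2025, Cor. 2.12] -/
theorem heartland_of_carrying (h : CarryingUpToAlgebraic) : MiddleStepHeartland := by
  intro q X hq hX ih hP c hc hh
  obtain ⟨D, hD, hcodim, m, hm, b, hb, hsupp⟩ := h hq hX ih hP c hc hh
  have h1 : m • c + b ∈ supportedClasses X (2 * q) 1 :=
    classesSupportedOn_le_supportedClasses hD hcodim _ hsupp
  have h2 : b ∈ supportedClasses X (2 * q) 1 :=
    supportedClasses_mono X (2 * q) (show 1 ≤ q by omega) hb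
  have h3 : m • c ∈ supportedClasses X (2 * q) 1 := by
    have := Submodule.sub_mem _ h1 h2
    simpa using this
  have h4 : c ∈ supportedClasses X (2 * q) 1 := (Submodule.smul_mem_iff _ hm).1 h3
  exact supportedHodgeClasses_algebraic_of_hodgeBelowDim ih hX c hc hh h4

/-- The full chain for CARD A: landing pad → heart → (with the Bloch–Srinivas regime) the crux. -/
theorem middleDivisorSupport_of_carrying
    (h₁ : Literature.Barriers.HodgeConjecture.BlochSrinivas1983_decompositionOfTheDiagonal)
    (h₂ : Literature.Barriers.HodgeConjecture.BlochSrinivas1983_decompositionOfTheDiagonal →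
      MiddleStepChowDegenerate)
    (hA : CarryingUpToAlgebraic) : MiddleDivisorSupport :=
  middleDivisorSupport_of_regimes h₁ h₂ (heartland_of_carrying hA)

/-- Sanity: HC ⟹ the landing pad (trivially, `b := -c`, `D := ∅`) — the pad is an INTERFACE. -/
theorem carrying_of_hodgeConjecture (hHC : _root_.HodgeConjecture) : CarryingUpToAlgebraic := by
  intro q X hq hX _ _ c hc hh
  refine ⟨∅, isClosed_empty, fun z hz ↦ (Set.notMem_empty z hz).elim, 1, one_ne_zero, -c, ?_, ?_⟩
  · exact Submodule.neg_mem _ ((hHC hX).2 q c hc hh)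
  · simp

end Summit.HodgeConjecture.HodgeConjecture.Cruxes.MiddleDivisorSupport.IdeatorOneSketch

end
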